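import Literature.MathematicalPhysics.QuantumFieldTheory.King1986.ContinuumLimitStatements
import Literature.MathematicalPhysics.QuantumFieldTheory.King1986.SliceSum
import HarnessLib

/-!
# King 1986 I, §3.3 pp. 663–665 AS PRINTED: the Hölder derivative (3.62), Proposition 3.7 (3.63)–(3.65), Proposition 3.8
# (3.71), the contour bound (3.72) and Proposition 3.9 (3.73)–(3.75) — the slice-propagator «kernel» estimates WITH the
# regular background field `A`, as hypothesis schemas over abstract slice kernels; (3.63) ⇒ the power-law profile PROVED

statement-level skeleton of published theorems with citation tags; proofs where landed; nothing here is a claim about the Yang–Mills mass gap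

C. King, *The U(1) Higgs model. I. The continuum limit*, Commun. Math. Phys. **102** (1986) 649–677 [King1986], §2.2 p. 653
((2.10)–(2.17)), §3.3 pp. 663–665.  PDF held: `paper:king1986-cmp102-king-u1-higgs-i` (journal page = PDF page + 648).  Page
renders read AS IMAGES for every quotation below: `run/shared/lean/pub/pub-balaban/b2b-balaban-template/king-renders/1986-cmp102-king-u1-higgs-I-p005-x2.png`
(p. 653), `…/b2b-balaban-t4-ne2-p3/king-renders/1986-cmp102-king-u1-higgs-I-p015-x2.png` (p. 663), `…/b2b-balaban-template/king-renders/…-p016-x2.png`,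
`…-p017-x2.png` (pp. 664–665).

CITATION HEADER (lean-in-tree rule).  Typed for the cell `lit-balaban` (seat `lit-balaban-type-King86`, R141 (B): *"King 1986 CMP
102:649 kernels"*) as the third file of the King 1986 statement inventory (`ContinuumLimitStatements` = §2.3–§3.2 of [K I],
`RotationInvarianceStatements` = [K II] §2/§4).  The tree PROVES these propositions for King's operators AT `A = 0` on the
torus, in Fourier form (`King1986/SliceSum`, `SingleScaleRate`, `MinimizerHolderDecay`, `MinimizerTwoSpacingHolder`,
`TopScalePiece`, `CovarianceQstar*`, `UniformDecay`, …; 34 files), and the ladder's N15 node cites «(3.71) p. 664», «(3.73)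
p. 665», «(3.64) p. 663» ≈ 80 times as the TEMPLATE of its estimates — but there was no declaration of the printed statements
themselves (regular `A ≠ 0`, Dirichlet data, the contour clauses (3.64)/(3.74), (3.72)).  This file types them, verbatim, as
predicates over ABSTRACT slice kernels with the printed constants left free (`C`, `δ₀`, `γ`), so that a consumer quantifies them as
print does (*"C depends on g, h"*, *"γ sufficiently small"*), and PROVES the one piece of bookkeeping that connects them to the
tree: (3.63) for all slices ⇒ the `|x − y|^{1−d}` profile of the telescoped gradient kernel (2.17) (`SliceSum.abs_sum_slices_le`).
WHAT IS REPRODUCED: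
* §0 **(3.62)** the Hölder derivative `(∂_α(x, y)G)(z) = |x − y|^{−α}{G(x, z) − G(y, z)}` as a definition over an abstract
  distance (`holderDeriv`), with its unfolding / symmetry / «bound ⇔ Hölder quotient bound» lemmas PROVED.
* §1 the slice kernels of **(2.17)** `G_k^ε = Σ_{j=0}^{k−1} G^ε_{(j)}` at level `k` (`η = L^{−k}`) as abstract data
  `SliceKernels` (kernels `G^η_{(j)}(x, y)`, their lattice gradients `∂^η_μG^η_{(j)}(x, y)`, the contour-contracted kernels
  `G^η_{(j)}(Γ^{(j+1)}_{x_{j+1},x}, b)` of (3.64), the distances `|x − y|`, `dist(B^j(x), b)`).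
* §2 **PROPOSITION 3.7** (3.63)–(3.65) `Prop37Printed`; §3 **PROPOSITION 3.8** (3.71) `Prop38Printed` and **(3.72)**
  `Ineq372Printed` (two spacings `η′ = L^{−(k+n)}`, `η = L^{−k}`, block map `x′ ↦ x` with `x′ ∈ B^n(x)`); §4 **PROPOSITION
  3.9** (3.73)–(3.75) `Prop39Printed`.
* §5 PROVED: `Prop37Printed ⇒` the hypothesis of `SliceSum.abs_sum_slices_le` for the gradient slices, hence
  `|Σ_{j<k} ∂^η_μG^η_{(j)}(x, y)| ≤ C·(2·d!/δ₀^d + 2)·|x − y|^{−(d−1)}` for `|x − y| ≥ η` (`abs_sum_dG_le`), uniformly in `k`.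

HONEST SCOPE.  Propositions 3.7–3.9 and (3.72) are HYPOTHESES here (schemas; King proves 3.7 from Theorem 3.3 = [Ba 4] by scaling,
and 3.8/3.9 in §4, whose `A = 0` content the tree has).  King's operators (2.13)–(2.17) with `A ≠ 0` are not constructed; the
abstract kernels carry no structure beyond what the displays use.  `d = 2, 3` as printed (the exponents are written in `d`).
Nothing here bears on Bałaban's 4-d Yang–Mills papers, infinite volume, a mass gap, or the Clay problem; count-neutral for the
ladder (no node discharged).
-/

noncomputable section

open Real Finset

namespace Literature.MathematicalPhysics.QuantumFieldTheory.King1986.SlicePropagator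

/-! ## §0 The Hölder derivative (3.62) -/

/-- **(3.62)** p. 663 [PDF 15], verbatim: *"Before proceeding, we state the required bounds on propagators. For a propagator
G(x, y), we define a "Holder derivative" by (∂_α(x, y)G)(z) = |x − y|^{−α}{G(x, z) − G(y, z)}. (3.62)"*  Over an abstract
distance `dist` (`|x − y|` on `T_η`); real power `|x − y|^{−α}` (`= 0` at `x = y` for `α ≠ 0`, Mathlib's convention for `0^{−α}`).
[cite: King1986, (3.62) p.663] -/
def holderDeriv {S Z : Type*} (dist : S → S → ℝ) (α : ℝ) (G : S → Z → ℝ) (x y : S) (z : Z) : ℝ :=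
  (dist x y) ^ (-α) * (G x z - G y z)

/-- Unfolding of (3.62). [cite: King1986, (3.62) p.663] -/
theorem holderDeriv_def {S Z : Type*} (dist : S → S → ℝ) (α : ℝ) (G : S → Z → ℝ) (x y : S) (z : Z) :
    holderDeriv dist α G x y z = (dist x y) ^ (-α) * (G x z - G y z) := rfl

/-- (3.62) as a quotient: `(∂_α(x, y)G)(z) = {G(x, z) − G(y, z)}/|x − y|^α` for `|x − y| > 0`. [cite: King1986, (3.62) p.663] -/
theorem holderDeriv_eq_div {S Z : Type*} {dist : S → S → ℝ} (α : ℝ) (G : S → Z → ℝ) {x y : S} (hxy : 0 < dist x y)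
    (z : Z) : holderDeriv dist α G x y z = (G x z - G y z) / (dist x y) ^ α := by
  rw [holderDeriv, Real.rpow_neg hxy.le, div_eq_inv_mul]

/-- Antisymmetry in `(x, y)` for a symmetric distance. [cite: King1986, (3.62) p.663] -/
theorem holderDeriv_swap {S Z : Type*} {dist : S → S → ℝ} (hsymm : ∀ x y, dist y x = dist x y) (α : ℝ)
    (G : S → Z → ℝ) (x y : S) (z : Z) : holderDeriv dist α G y x z = -holderDeriv dist α G x y z := by
  simp only [holderDeriv, hsymm x y]
  ring

/-- A bound on the Hölder derivative IS a Hölder-quotient bound: `|(∂_α(x, y)G)(z)| ≤ B ⇔ |G(x, z) − G(y, z)| ≤ B|x − y|^α`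
(`|x − y| > 0`). [cite: King1986, (3.62) p.663] -/
theorem abs_holderDeriv_le_iff {S Z : Type*} {dist : S → S → ℝ} (α : ℝ) (G : S → Z → ℝ) {x y : S}
    (hxy : 0 < dist x y) (z : Z) (B : ℝ) :
    |holderDeriv dist α G x y z| ≤ B ↔ |G x z - G y z| ≤ B * (dist x y) ^ α := by
  have hpos : 0 < (dist x y) ^ α := Real.rpow_pos_of_pos hxy α
  rw [holderDeriv_eq_div α G hxy, abs_div, abs_of_pos hpos, div_le_iff₀ hpos]

/-- The Hölder derivative is linear in the kernel (differences of propagators, as in (3.75)). [cite: King1986, (3.62) p.663, (3.75) p.665] -/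
theorem holderDeriv_sub {S Z : Type*} (dist : S → S → ℝ) (α : ℝ) (G G' : S → Z → ℝ) (x y : S) (z : Z) :
    holderDeriv dist α (fun a b => G a b - G' a b) x y z = holderDeriv dist α G x y z - holderDeriv dist α G' x y z := by
  simp only [holderDeriv]
  ring

/-! ## §1 The slice kernels of (2.17) at level `k` -/

/-- **The slice kernels of (2.17)**, p. 653 [PDF 5], verbatim: *"The operator (2.13) can be decomposed into a sum of
contributions from scales between Ω and Ω^{(k)}: G^ε_k(Ω, A) = C^{(0),ε}(Ω, A) + Σ_{j=1}^{k−1} a_j²(L^jε)^{−4}G^ε_j(Ω, A)Q_j(A)*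
C^{(j),L^jε}(Ω, A)Q_j(A)G^ε_j(Ω, A) ≡ Σ_{j=0}^{k−1} G^ε_{(j)}(Ω, A), (2.17) with the obvious definition of G^ε_{(j)}(Ω, A)."*; p. 663:
*"Every internal line in H̃ carries a propagator G_k, G_k(0) or one of their derivatives, which may be decomposed by writing
G^η_k = Σ_{j=0}^{k−1} G^η_{(j)}, see (2.17)."*  ABSTRACT DATA at level `k` (after rescaling to the `η`-lattice, `η = L^{−k}`): the
sites `S` and bonds `B` of `T_η`, the distance `|x − y|` and the block-to-bond distance `dist(B^j(x), b)` of (3.64), and the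
kernels `G j x y = G^η_{(j)}(x, y)`, `dG j μ x y = ∂^η_μG^η_{(j)}(x, y)`, `Gc j x b = G^η_{(j)}(Γ^{(j+1)}_{x_{j+1},x}, b)` (the kernel
contracted along the contour (2.12) from the block centre `x_{j+1}` to `x`, paired with the bond `b`).  The operators themselves
(regular `A`, Definition 3.2) are not constructed. [cite: King1986, (2.17) p.653, (3.62)–(3.64) p.663] -/
structure SliceKernels (d : ℕ) where
  /-- sites of `T_η` -/
  S : Type
  /-- bonds of `T_η` -/
  B : Type
  /-- `|x − y|` -/
  dist : S → S → ℝ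
  /-- `dist(B^j(x), b)` -/
  distBlockBond : ℕ → S → B → ℝ
  /-- the block size `L` and the level `k` (`η = L^{−k}`) -/
  L : ℕ
  k : ℕ
  /-- `G^η_{(j)}(x, y)` -/
  G : ℕ → S → S → ℝ
  /-- `∂^η_μ G^η_{(j)}(x, y)` -/
  dG : ℕ → Fin d → S → S → ℝ
  /-- `G^η_{(j)}(Γ^{(j+1)}_{x_{j+1},x}, b)` -/
  Gc : ℕ → S → B → ℝ

namespace SliceKernels

variable {d : ℕ} (D : SliceKernels d)

/-- `η = L^{−k}` (p. 657: *"After rescaling to the η-lattice (η = L^{−k})"*) — [K I]'s `ContinuumLimit.eps L k`.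
[cite: King1986, (3.14) p.657] -/
def η : ℝ := ContinuumLimit.eps D.L D.k

/-- The slice length `L^jη` of (3.63)–(3.65). [cite: King1986, (3.63) p.663] -/
def slice (j : ℕ) : ℝ := (D.L : ℝ) ^ j * D.η

/-- `L^jη > 0` for `L ≥ 1`. [cite: King1986, (3.63) p.663] -/
theorem slice_pos (hL : 0 < D.L) (j : ℕ) : 0 < D.slice j := by
  unfold slice η
  have := ContinuumLimit.eps_pos hL D.k
  have hL' : (0 : ℝ) < D.L := by exact_mod_cast hL
  positivity

/-- `L^jη = η·L^j` (the spelling of `SliceSum.abs_sum_slices_le`). [cite: King1986, (3.63) p.663] -/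
theorem slice_eq (j : ℕ) : D.slice j = D.η * (D.L : ℝ) ^ j := by
  unfold slice; ring

/-- The telescoped gradient kernel `∂^η_μ G^η_k(x, y) = Σ_{j=0}^{k−1} ∂^η_μ G^η_{(j)}(x, y)` of (2.17) (as the finite sum of the
slice data). [cite: King1986, (2.17) p.653] -/
def dGsum (μ : Fin d) (x y : D.S) : ℝ := ∑ j ∈ Finset.range D.k, D.dG j μ x y

end SliceKernels

/-! ## §2 Proposition 3.7 (3.63)–(3.65) -/

/-- **PROPOSITION 3.7** p. 663 [PDF 15], verbatim: *"**Proposition 3.7.** For x, y, z ∈ T_η, 0 < α < 1, and all 0 ≤ j ≤ k − 1,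
|G^η_{(j)}(x, y)|, |∂^η_μG^η_{(j)}(x, y)| ≤ C{(L^jη)^{2−d}, (L^jη)^{1−d}}·exp[−δ₀(L^jη)^{−1}|x − y|], (3.63)
|G^η_{(j)}(Γ^{(j+1)}_{x_{j+1},x}, b)| ≤ C(L^jη)^{3−d} exp[−δ₀(L^jη)^{−1} dist(B^j(x), b)], (3.64)
|∂_α(x, y)G^η_{(j)}(z)|, |∂_α(x, y)∂^η_μG^η_{(j)}(z)| ≤ C{(L^jη)^{2−d−α}, (L^jη)^{1−d−α}} exp[−δ₀(L^jη)^{−1} dist({x, y}, z)]. (3.65)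
Furthermore, if we replace G^η_{(j)} by G^{η′}_{(j)} throughout, and replace Γ^{(j+1)}_{x_{j+1},x} by Γ^{(j+n+1)}_{x_{j+n+1},x}, then the bounds
are valid for −n ≤ j ≤ k − 1. Proposition 3.7 follows immediately from Theorem 3.3 and the scaling properties of the
operators."*  TYPED with the printed constants `C`, `δ₀` FREE (King: `C` generic, *"depends on g, h"*; uniform in `k`, `j`, `η`),
`dist({x, y}, z) = min(|x − z|, |y − z|)`, the Hölder clause for `x ≠ y` (`|x − y| > 0`), real powers of the slice length
`L^jη > 0`.  The «Furthermore» clause (negative `j`, primed lattice) is not typed separately (it is the same predicate on the level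
`k + n` data).  HYPOTHESIS SCHEMA. [cite: King1986, Prop 3.7 (3.63)–(3.65) p.663] -/
def Prop37Printed {d : ℕ} (D : SliceKernels d) (C δ₀ : ℝ) : Prop :=
  ∀ j : ℕ, j + 1 ≤ D.k →
    (∀ x y : D.S,
      |D.G j x y| ≤ C * (D.slice j) ^ ((2 : ℝ) - d) * Real.exp (-(δ₀ * (D.slice j)⁻¹ * D.dist x y)) ∧
      ∀ μ : Fin d, |D.dG j μ x y| ≤ C * (D.slice j) ^ ((1 : ℝ) - d) * Real.exp (-(δ₀ * (D.slice j)⁻¹ * D.dist x y))) ∧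
    (∀ (x : D.S) (b : D.B),
      |D.Gc j x b| ≤ C * (D.slice j) ^ ((3 : ℝ) - d) * Real.exp (-(δ₀ * (D.slice j)⁻¹ * D.distBlockBond j x b))) ∧
    (∀ α : ℝ, 0 < α → α < 1 → ∀ x y z : D.S, 0 < D.dist x y →
      |holderDeriv D.dist α (D.G j) x y z|
          ≤ C * (D.slice j) ^ ((2 : ℝ) - d - α) * Real.exp (-(δ₀ * (D.slice j)⁻¹ * min (D.dist x z) (D.dist y z))) ∧
      ∀ μ : Fin d, |holderDeriv D.dist α (D.dG j μ) x y z|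
          ≤ C * (D.slice j) ^ ((1 : ℝ) - d - α) * Real.exp (-(δ₀ * (D.slice j)⁻¹ * min (D.dist x z) (D.dist y z))))

/-! ## §3 Two spacings: Proposition 3.8 (3.71) and the contour bound (3.72) -/

/-- **The two-spacing data of Propositions 3.8/3.9 and (3.72)**, p. 664 [PDF 16]: *"When x′ ∈ T_{η′}, we denote by x that
point in T_η for which x′ ∈ B^n(x)."*; the propagators of the models from `ε_K` (`k` steps, lattice `T_η`, `η = L^{−k}`) and from
`ε_{K+n}` (`k + n` steps, `T_{η′}`, `η′ = L^{−(k+n)}`) on the SAME unit lattice `T^{(k)}` (p. 656).  ABSTRACT DATA: the level-`k`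
and level-`(k+n)` slice data `lo`, `hi` (`hi.k = lo.k + n`, same `L`), the block maps `pt : x′ ↦ x`, `bd : b′ ↦ b`, the unit-lattice
predicate `IsUnit z` (`z ∈ T^{(k)} ⊂ T_η`), and the external-line kernels of (3.71): `K x z = a_kG^η_kQ_k^*(x, z)`,
`dK μ x z = a_k∂^η_μG^η_kQ_k^*(x, z)` (`x ∈ T_η`, `z ∈ T^{(k)}`) and their primed versions `K′ x′ z`, `dK′ μ x′ z` (`x′ ∈ T_{η′}`).
[cite: King1986, Prop 3.8 (3.71) p.664, Prop 3.9 p.665] -/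
structure TwoSpacing (d : ℕ) where
  /-- level `k`: `T_η` -/
  lo : SliceKernels d
  /-- level `k + n`: `T_{η′}` -/
  hi : SliceKernels d
  /-- the number of extra steps `n` -/
  n : ℕ
  k_hi : hi.k = lo.k + n
  L_hi : hi.L = lo.L
  /-- `x′ ↦ x` with `x′ ∈ B^n(x)` -/
  pt : hi.S → lo.S
  /-- `b′ ↦ b` -/
  bd : hi.B → lo.B
  /-- `z ∈ T^{(k)}` (unit-lattice points of `T_η`) -/
  IsUnit : lo.S → Prop
  /-- `a_k G^η_k Q_k^*(x, z)` -/
  K : lo.S → lo.S → ℝ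
  /-- `a_k ∂^η_μ G^η_k Q_k^*(x, z)` -/
  dK : Fin d → lo.S → lo.S → ℝ
  /-- `a_{k+n} G^{η′}_{k+n} Q_{k+n}^*(x′, z)` -/
  K' : hi.S → lo.S → ℝ
  /-- `a_{k+n} ∂^{η′}_μ G^{η′}_{k+n} Q_{k+n}^*(x′, z)` -/
  dK' : Fin d → hi.S → lo.S → ℝ

/-- **PROPOSITION 3.8** p. 664 [PDF 16], verbatim: *"First, we replace the propagators on the external lines, using the following
proposition proved in Sect. 4. When x′ ∈ T_{η′}, we denote by x that point in T_η for which x′ ∈ B^n(x). **Proposition 3.8.** For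
x′, y′ ∈ T_{η′}, 0 < α < 1, and γ sufficiently small,
|a_{k+n}G^{η′}_{k+n}Q^*_{k+n}(x′, z) − a_kG^η_kQ^*_k(x, z)|, |a_{k+n}∂^{η′}_μG^{η′}_{k+n}Q^*_{k+n}(x′, z) − a_k∂^η_μG^η_kQ^*_k(x, z)|,
|(∂_α(x′, y′)a_{k+n}G^{η′}_{k+n}Q^*_{k+n})(z) − (∂_α(x, y)a_kG^η_kQ^*_k)(z)|, |(∂_α(x′, y′)a_{k+n}∂^{η′}_μG^{η′}_{k+n}Q^*_{k+n})(z) −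
(∂_α(x, y)a_k∂^η_μG^η_kQ^*_k)(z)| ≤ CL^{−γk} exp[−δ₀{|x − z|, dist({x, y}, z)}]. (3.71)"*  TYPED with `C`, `δ₀`, `γ` FREE (*"γ
sufficiently small"*: the consumer quantifies `γ`), `z` ranging over the unit lattice `T^{(k)}`, the first two lines with
`exp[−δ₀|x − z|]`, the Hölder lines (for `x′ ≠ y′`, `x ≠ y`) with `exp[−δ₀ dist({x, y}, z)]`, as printed.  HYPOTHESIS SCHEMA.
[cite: King1986, Prop 3.8 (3.71) p.664] -/
def Prop38Printed {d : ℕ} (T : TwoSpacing d) (C δ₀ γ : ℝ) : Prop :=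
  (∀ (x' : T.hi.S) (z : T.lo.S), T.IsUnit z →
    |T.K' x' z - T.K (T.pt x') z| ≤ C * (T.lo.L : ℝ) ^ (-(γ * T.lo.k)) * Real.exp (-(δ₀ * T.lo.dist (T.pt x') z)) ∧
    ∀ μ : Fin d, |T.dK' μ x' z - T.dK μ (T.pt x') z|
      ≤ C * (T.lo.L : ℝ) ^ (-(γ * T.lo.k)) * Real.exp (-(δ₀ * T.lo.dist (T.pt x') z))) ∧
  (∀ α : ℝ, 0 < α → α < 1 → ∀ (x' y' : T.hi.S) (z : T.lo.S), T.IsUnit z → 0 < T.hi.dist x' y' →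
    0 < T.lo.dist (T.pt x') (T.pt y') →
    |holderDeriv T.hi.dist α T.K' x' y' z - holderDeriv T.lo.dist α T.K (T.pt x') (T.pt y') z|
        ≤ C * (T.lo.L : ℝ) ^ (-(γ * T.lo.k))
          * Real.exp (-(δ₀ * min (T.lo.dist (T.pt x') z) (T.lo.dist (T.pt y') z))) ∧
    ∀ μ : Fin d, |holderDeriv T.hi.dist α (T.dK' μ) x' y' z - holderDeriv T.lo.dist α (T.dK μ) (T.pt x') (T.pt y') z|
        ≤ C * (T.lo.L : ℝ) ^ (-(γ * T.lo.k))
          * Real.exp (-(δ₀ * min (T.lo.dist (T.pt x') z) (T.lo.dist (T.pt y') z))))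

/-- **(3.72)** p. 665 [PDF 17], verbatim: *"The operator (3.46) can be replaced using the following bound: |U(B(Γ^{(k+n)}_{x₀,x′})) −
U(B(Γ^{(k)}_{x₀,x}))| ≤ Ce(L^kε)^{2−d/2}L^{−k} p(L^kε)/(μ₀L^kε). (3.72)"*  Over abstract contour phases `U′ x′ = U(B(Γ^{(k+n)}_{x₀,x′}))`,
`U x = U(B(Γ^{(k)}_{x₀,x})) ∈ ℂ` (the background vector field `B`, the contours (2.12) and the base point `x₀` are parameters of
the data), with `p(·) = Balaban1983to89.B2.pFn b₀ p ·` ([K I] (3.1)), the charge `e`, the vector mass `μ₀`, the running scale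
`L^kε`; `C` FREE.  HYPOTHESIS SCHEMA. [cite: King1986, (3.72) p.665] -/
def Ineq372Printed {S S' : Type*} (d : ℕ) (pt : S' → S) (U : S → ℂ) (U' : S' → ℂ) (L k : ℕ)
    (e μ₀ Lkε b₀ p C : ℝ) : Prop :=
  ∀ x' : S', ‖U' x' - U (pt x')‖
    ≤ C * e * Lkε ^ ((2 : ℝ) - (d : ℝ) / 2) * ((L : ℝ) ^ k)⁻¹ * (Balaban1983to89.B2.pFn b₀ p Lkε / (μ₀ * Lkε))

/-! ## §4 Proposition 3.9 (3.73)–(3.75) -/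

/-- **PROPOSITION 3.9** p. 665 [PDF 17], verbatim: *"Now we replace propagators on the internal lines, using the following
proposition (also proved in Sect. 4): **Proposition 3.9.** For 0 ≤ j ≤ k − 1, 0 < α < 1, and γ sufficiently small,
|G^{η′}_{(j)}(x′, y′) − G^η_{(j)}(x, y)|, |∂^{η′}_μG^{η′}_{(j)}(x′, y′) − ∂^η_μG^η_{(j)}(x, y)| ≤ CL^{−γk}{(L^jη)^{2−d−γ}, (L^jη)^{1−d−γ}}
exp[−δ₀(L^jη)^{−1}|x − y|], (3.73)
|G^{η′}_{(j)}(Γ^{(j+n+1)}_{x_{j+n+1},x′}, b′) − G^η_{(j)}(Γ^{(j+1)}_{x_{j+1},x}, b)| ≤ CL^{−γk}(L^jη)^{3−d−γ} exp[−δ₀(L^jη)^{−1} dist(B^j(x), b)], (3.74)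
|(∂_α(x′, y′)G^{η′}_{(j)})(z′) − (∂_α(x, y)G^η_{(j)})(z)|, |(∂_α(x′, y′)∂^{η′}_μG^{η′}_{(j)})(z′) − (∂_α(x, y)∂^η_μG^η_{(j)})(z)|
≤ CL^{−γk}{(L^jη)^{2−d−α−γ}, (L^jη)^{1−d−α−γ}} exp[−δ₀ dist({x, y}, z)]. (3.75)"*  TYPED over `TwoSpacing` data (`x = pt x′`,
`y = pt y′`, `z = pt z′`, `b = bd b′`; slice lengths `L^jη` of the COARSE lattice), `C`, `δ₀`, `γ` FREE (*"γ sufficiently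
small"*), the Hölder lines for `x′ ≠ y′`, `x ≠ y`; (3.75)'s exponential WITHOUT the factor `(L^jη)^{−1}`, exactly as printed.
HYPOTHESIS SCHEMA. [cite: King1986, Prop 3.9 (3.73)–(3.75) p.665] -/
def Prop39Printed {d : ℕ} (T : TwoSpacing d) (C δ₀ γ : ℝ) : Prop :=
  ∀ j : ℕ, j + 1 ≤ T.lo.k →
    (∀ x' y' : T.hi.S,
      |T.hi.G j x' y' - T.lo.G j (T.pt x') (T.pt y')|
          ≤ C * (T.lo.L : ℝ) ^ (-(γ * T.lo.k)) * (T.lo.slice j) ^ ((2 : ℝ) - d - γ)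
            * Real.exp (-(δ₀ * (T.lo.slice j)⁻¹ * T.lo.dist (T.pt x') (T.pt y'))) ∧
      ∀ μ : Fin d, |T.hi.dG j μ x' y' - T.lo.dG j μ (T.pt x') (T.pt y')|
          ≤ C * (T.lo.L : ℝ) ^ (-(γ * T.lo.k)) * (T.lo.slice j) ^ ((1 : ℝ) - d - γ)
            * Real.exp (-(δ₀ * (T.lo.slice j)⁻¹ * T.lo.dist (T.pt x') (T.pt y')))) ∧
    (∀ (x' : T.hi.S) (b' : T.hi.B),
      |T.hi.Gc j x' b' - T.lo.Gc j (T.pt x') (T.bd b')|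
          ≤ C * (T.lo.L : ℝ) ^ (-(γ * T.lo.k)) * (T.lo.slice j) ^ ((3 : ℝ) - d - γ)
            * Real.exp (-(δ₀ * (T.lo.slice j)⁻¹ * T.lo.distBlockBond j (T.pt x') (T.bd b')))) ∧
    (∀ α : ℝ, 0 < α → α < 1 → ∀ x' y' z' : T.hi.S, 0 < T.hi.dist x' y' → 0 < T.lo.dist (T.pt x') (T.pt y') →
      |holderDeriv T.hi.dist α (T.hi.G j) x' y' z' - holderDeriv T.lo.dist α (T.lo.G j) (T.pt x') (T.pt y') (T.pt z')|
          ≤ C * (T.lo.L : ℝ) ^ (-(γ * T.lo.k)) * (T.lo.slice j) ^ ((2 : ℝ) - d - α - γ)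
            * Real.exp (-(δ₀ * min (T.lo.dist (T.pt x') (T.pt z')) (T.lo.dist (T.pt y') (T.pt z')))) ∧
      ∀ μ : Fin d,
        |holderDeriv T.hi.dist α (T.hi.dG j μ) x' y' z' - holderDeriv T.lo.dist α (T.lo.dG j μ) (T.pt x') (T.pt y') (T.pt z')|
          ≤ C * (T.lo.L : ℝ) ^ (-(γ * T.lo.k)) * (T.lo.slice j) ^ ((1 : ℝ) - d - α - γ)
            * Real.exp (-(δ₀ * min (T.lo.dist (T.pt x') (T.pt z')) (T.lo.dist (T.pt y') (T.pt z')))))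

/-! ## §5 PROVED: Proposition 3.7 (3.63) for all slices ⇒ the power-law profile of the telescoped gradient kernel (2.17) -/

/-- Real power of the slice length as printed, `(L^jη)^{1−d}`, in the division form used by `SliceSum`: `= 1/(ηL^j)^{d−1}`
(`d ≥ 1`). [cite: King1986, (3.63) p.663] -/
theorem slice_rpow_one_sub {d : ℕ} (D : SliceKernels d) (hL : 0 < D.L) (hd : 1 ≤ d) (j : ℕ) :
    (D.slice j) ^ ((1 : ℝ) - d) = ((D.η * (D.L : ℝ) ^ j) ^ (d - 1))⁻¹ := by
  have hs := D.slice_pos hL j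
  rw [← D.slice_eq j, ← Real.rpow_natCast, ← Real.rpow_neg hs.le]
  congr 1
  rw [Nat.cast_sub hd]
  push_cast
  ring

/-- **(3.63), gradient clause, in the hypothesis form of `SliceSum.abs_sum_slices_le`** (`p = d − 1`, `δ = δ₀`, `ρ = |x − y|`,
slices `ηL^j`): Proposition 3.7 gives `|∂^η_μG^η_{(j)}(x, y)| ≤ C·exp(−δ₀|x − y|/(ηL^j))/(ηL^j)^{d−1}` for all `j < k`.
[cite: King1986, Prop 3.7 (3.63) p.663] -/
theorem dG_sliceShape_of_prop37 {d : ℕ} (D : SliceKernels d) (hL : 0 < D.L) (hd : 1 ≤ d) {C δ₀ : ℝ}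
    (h37 : Prop37Printed D C δ₀) (μ : Fin d) :
    ∀ j < D.k, ∀ x y : D.S, |D.dG j μ x y|
      ≤ C * (Real.exp (-(δ₀ * (D.dist x y / (D.η * (D.L : ℝ) ^ j)))) / (D.η * (D.L : ℝ) ^ j) ^ (d - 1)) := by
  intro j hj x y
  have h := ((h37 j (by omega)).1 x y).2 μ
  rw [slice_rpow_one_sub D hL hd j] at h
  have hexp : Real.exp (-(δ₀ * (D.slice j)⁻¹ * D.dist x y))
      = Real.exp (-(δ₀ * (D.dist x y / (D.η * (D.L : ℝ) ^ j)))) := by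
    rw [D.slice_eq j]; ring_nf
  rw [hexp] at h
  calc |D.dG j μ x y| ≤ C * ((D.η * (D.L : ℝ) ^ j) ^ (d - 1))⁻¹
        * Real.exp (-(δ₀ * (D.dist x y / (D.η * (D.L : ℝ) ^ j)))) := h
    _ = C * (Real.exp (-(δ₀ * (D.dist x y / (D.η * (D.L : ℝ) ^ j)))) / (D.η * (D.L : ℝ) ^ j) ^ (d - 1)) := by
        rw [div_eq_mul_inv]; ring

/-- **PROPOSITION 3.7 ⇒ THE `|x − y|^{1−d}` PROFILE OF THE TELESCOPED GRADIENT KERNEL, uniformly in `k`, PROVED** (the use made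
of (3.63) on p. 664: *"We get an upper bound for this expression by replacing every propagator by the bounds given in Proposition
3.7"*; the summation over slices is the tree's `SliceSum.abs_sum_slices_le`): for `L ≥ 2`, `d ≥ 2`, `C ≥ 0`, `δ₀ > 0` and
`|x − y| ≥ η`, `|Σ_{j<k} ∂^η_μG^η_{(j)}(x, y)| ≤ C·(2·d!/δ₀^d + 2)/|x − y|^{d−1}`. [cite: King1986, Prop 3.7 (3.63) p.663, (2.17) p.653] -/
theorem abs_sum_dG_le {d : ℕ} (D : SliceKernels d) (hL : 2 ≤ D.L) (hd : 2 ≤ d) {C δ₀ : ℝ} (hC : 0 ≤ C) (hδ₀ : 0 < δ₀)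
    (h37 : Prop37Printed D C δ₀) (μ : Fin d) (x y : D.S) (hxy : D.η ≤ D.dist x y) :
    |D.dGsum μ x y| ≤ C * ((2 * ((d - 1) + 1).factorial / δ₀ ^ ((d - 1) + 1) + 2) / D.dist x y ^ (d - 1)) := by
  have hL0 : 0 < D.L := by omega
  have hLr : (2 : ℝ) ≤ D.L := by exact_mod_cast hL
  have hη : 0 < D.η := ContinuumLimit.eps_pos hL0 D.k
  unfold SliceKernels.dGsum
  exact abs_sum_slices_le (fun j a b => D.dG j μ a b) D.dist (D.L : ℝ) D.η δ₀ C (d - 1) D.k hLr hη hδ₀ hC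
    (by omega) (dG_sliceShape_of_prop37 D hL0 (by omega) h37 μ) x y hxy

end Literature.MathematicalPhysics.QuantumFieldTheory.King1986.SlicePropagator

end
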